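import Summits.NavierStokesRegularity.NavierStokesRegularity.Theorems.IntenseSetDoorsDefs
import Summits.NavierStokesRegularity.NavierStokesRegularity.Theorems.CriticalCoherenceDoorGronwallTools
import HarnessLib

/-!
# IntenseSetDoorsGronwall — door family S34 «IntenseSetDoors», plate G34 «ForcedPowerGronwallSlab», PROVED

S-door lane helper (ns-s29-p2 g4, LEAD ns-s30-p1 g2's plate map 2026-08-28T14:21:00Z key (4); texts of record
nsreg-p1 g28 `r32/Sketch34.lean` sha16 c542dddc314f2f7c = tree P0 `Theorems/IntenseSetDoorsDefs.lean`),
`--supports stmt-NavierStokesRegularity-0056 --as helper`.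

`forcedPowerGronwallSlab_holds : ForcedPowerGronwallSlab` BY NAME against P0.  Two parts:

* `forced_power_gronwall_real` — the real-variable heart (the INTEGRATING FACTOR, not Grönwall's lemma: the
  forcing `β(T−t)^{−c}` with `c < a+1` need not be integrable, so the exponential form of Grönwall does not give
  the text's constant).  If `Y` is continuous on `[0,T'']`, `Y(b) = Y(0) + ∫₀ᵇ Φ` with `Φ` integrable and
  `Φ ≤ (a/(T−t))Y + β(T−t)^{−c}` on `[0,T'']` (`T'' < T`, `a, β ≥ 0`, `c < a+1`), put
  `V(t) = Y(0) + ∫₀ᵗ ((a/(T−s))Y + β(T−s)^{−c}) ds ≥ Y(t)` (a `C¹` majorant, FTC for the continuous integrand)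
  and `W(t) = (T−t)^a V(t) + (β/e)(T−t)^e`, `e = a+1−c > 0`: then `W' = a(T−t)^{a−1}(Y − V) ≤ 0` in the
  interior, so `W` is antitone (`antitoneOn_of_deriv_nonpos`) and `W(t) ≤ W(0) = T^a Y(0) + (β/e)T^e`, whence
  `Y(t) ≤ V(t) ≤ (Y(0)T^a + βT^{a+1−c}/(a+1−c))(T−t)^{−a}`.
* `forcedPowerGronwallSlab_holds` — the slab bookkeeping of the tree's `integral_sq_norm_curl_le_of_direction_slab`
  (vorticity equation on the slab, `IsSmoothSpaceTimeOn.l2_balance` — whose integrability clause is now USED —, the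
  energy identity `integral_inner_curl_eq_of_vorticity_eq`, the `L²` size of `∂ₜω` via the G33 tool
  `CriticalCoherenceDoor.lintegral_enorm_sq_le_of_vorticity_eq`, p637790) feeding the real lemma.

WHAT THIS IS NOT: the Grönwall plate of three regularity CRITERIA about hypothetical blow-up; item 0056 `NoTypeII`
and NS regularity are NOT proved; no Literature fact is taken as a hypothesis; nothing here is a route or a summit
statement.
-/

noncomputable section

open MeasureTheory Set Function Filter Metric Real InnerProductSpace
open _root_.Topology
open scoped ENNReal NNReal RealInnerProductSpace ContDiff Laplacian
open Literature.Analysis.FluidPDE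
open Summit.NavierStokesRegularity.NavierStokesRegularity.Theorems.CriticalCoherenceDoor

set_option linter.dupNamespace false

namespace Summit.NavierStokesRegularity.NavierStokesRegularity.Theorems.IntenseSetDoors

-- nested operator types (second and third derivatives)
set_option maxSynthPendingDepth 3

/-- support (real analysis; the integrating factor `(T−t)^a`).  Let `0 < T'' < T`, `0 ≤ a`, `0 ≤ β`,
`c < a + 1`; let `Y` be continuous on `[0,T'']` with `Y(b) = Y(0) + ∫₀ᵇ Φ` for `b ∈ ]0,T'']`, `Φ` integrable
on `]0,T''[`, and `Φ(t) ≤ (a/(T−t))Y(t) + β(T−t)^{−c}` on `[0,T'']`.  Then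
`Y(t) ≤ (Y(0)T^a + βT^{a+1−c}/(a+1−c))(T−t)^{−a}` on `[0,T'']`.  (Majorant `V = Y(0) + ∫₀ᵗ((a/(T−s))Y + β(T−s)^{−c})`,
`W = (T−t)^a V + (β/e)(T−t)^e`, `e = a+1−c`; `W' = a(T−t)^{a−1}(Y − V) ≤ 0`; `antitoneOn_of_deriv_nonpos`.) -/
theorem forced_power_gronwall_real {T T'' a β c : ℝ} (hT'' : 0 < T'') (hT''T : T'' < T) (ha : 0 ≤ a)
    (hβ : 0 ≤ β) (hc : c < a + 1) {Y Φ : ℝ → ℝ} (hYc : ContinuousOn Y (Icc 0 T''))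
    (hΦi : IntegrableOn Φ (Ioo 0 T''))
    (hbal : ∀ b ∈ Ioc 0 T'', Y b = Y 0 + ∫ t in (0 : ℝ)..b, Φ t)
    (hΦle : ∀ t ∈ Icc 0 T'', Φ t ≤ a / (T - t) * Y t + β * (T - t) ^ (-c)) :
    ∀ t ∈ Icc 0 T'', Y t ≤ (Y 0 * T ^ a + β * T ^ (a + 1 - c) / (a + 1 - c)) * (T - t) ^ (-a) := by
  have hT : 0 < T := hT''.trans hT''T
  have hTt : ∀ t ∈ Icc 0 T'', 0 < T - t := fun t ht => by linarith [ht.2]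
  set e : ℝ := a + 1 - c with he
  have he0 : 0 < e := by rw [he]; linarith
  -- the comparison integrand `g = (a/(T−t)) Y + β (T−t)^{−c}`, continuous on the slab
  set g : ℝ → ℝ := fun t => a / (T - t) * Y t + β * (T - t) ^ (-c) with hg
  have hgc : ContinuousOn g (Icc 0 T'') := by
    have h1 : ContinuousOn (fun t : ℝ => a / (T - t)) (Icc 0 T'') :=
      continuousOn_const.div (continuousOn_const.sub continuousOn_id) fun t ht => (hTt t ht).ne'
    have h2 : ContinuousOn (fun t : ℝ => β * (T - t) ^ (-c)) (Icc 0 T'') :=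
      continuousOn_const.mul ((continuousOn_const.sub continuousOn_id).rpow_const
        fun t ht => Or.inl (hTt t ht).ne')
    exact (h1.mul hYc).add h2
  -- the majorant `V t = Y 0 + ∫₀ᵗ g`
  set V : ℝ → ℝ := fun t => Y 0 + ∫ s in (0 : ℝ)..t, g s with hV
  have hV0 : V 0 = Y 0 := by simp [hV]
  -- (i) `Y ≤ V` on the slab
  have hYV : ∀ t ∈ Icc 0 T'', Y t ≤ V t := by
    intro t ht
    rcases eq_or_lt_of_le ht.1 with h0 | ht0
    · rw [← h0, hV0]
    have hb := hbal t ⟨ht0, ht.2⟩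
    rw [hb]
    refine add_le_add le_rfl ?_
    refine intervalIntegral.integral_mono_on ht0.le ?_ ?_ fun s hs => hΦle s ⟨hs.1, hs.2.trans ht.2⟩
    · exact (intervalIntegrable_iff_integrableOn_Ioo_of_le ht0.le).2
        (hΦi.mono_set (Ioo_subset_Ioo le_rfl ht.2))
    · exact (hgc.mono (Icc_subset_Icc_right ht.2)).intervalIntegrable_of_Icc ht0.le
  -- (ii) `V' = g` in the interior, `V` continuous on the slab
  have hVd : ∀ t ∈ Ioo 0 T'', HasDerivAt V (g t) t := by
    intro t ht
    have hint : IntervalIntegrable g volume 0 t :=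
      (hgc.mono (Icc_subset_Icc_right ht.2.le)).intervalIntegrable_of_Icc ht.1.le
    have hmeas : StronglyMeasurableAtFilter g (𝓝 t) :=
      (hgc.mono Ioo_subset_Icc_self).stronglyMeasurableAtFilter isOpen_Ioo t ht
    have hca : ContinuousAt g t :=
      (hgc.mono Ioo_subset_Icc_self).continuousAt (Ioo_mem_nhds ht.1 ht.2)
    exact (intervalIntegral.integral_hasDerivAt_right hint hmeas hca).const_add (Y 0)
  have hVc : ContinuousOn V (Icc 0 T'') := by
    have hprim : ContinuousOn (fun t => ∫ s in (0 : ℝ)..t, g s) (Icc 0 T'') := by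
      have h := intervalIntegral.continuousOn_primitive_interval (μ := volume) (a := (0 : ℝ))
        (b := T'') (f := g) (by rw [uIcc_of_le hT''.le]; exact hgc.integrableOn_Icc)
      rwa [uIcc_of_le hT''.le] at h
    exact continuousOn_const.add hprim
  -- (iii) `W t = (T−t)^a V t + (β/e)(T−t)^e` is antitone on the slab
  set W : ℝ → ℝ := fun t => (T - t) ^ a * V t + β / e * (T - t) ^ e with hW
  have hXd : ∀ t ∈ Ioo 0 T'', ∀ r : ℝ,
      HasDerivAt (fun s : ℝ => (T - s) ^ r) ((-1) * r * (T - t) ^ (r - 1)) t := by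
    intro t ht r
    have h : HasDerivAt (fun s : ℝ => T - s) (-1) t := by
      simpa using (hasDerivAt_id t).const_sub T
    exact h.rpow_const (Or.inl (hTt t ⟨ht.1.le, ht.2.le⟩).ne')
  have hWd : ∀ t ∈ Ioo 0 T'', HasDerivAt W (a * (T - t) ^ (a - 1) * (Y t - V t)) t := by
    intro t ht
    have hX : 0 < T - t := hTt t ⟨ht.1.le, ht.2.le⟩
    have hraw : HasDerivAt W ((-1) * a * (T - t) ^ (a - 1) * V t + (T - t) ^ a * g t +
        β / e * ((-1) * e * (T - t) ^ (e - 1))) t :=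
      (((hXd t ht a).mul (hVd t ht)).add ((hXd t ht e).const_mul (β / e)))
    refine hraw.congr_deriv ?_
    have h1 : (T - t) ^ a * (a / (T - t)) = a * (T - t) ^ (a - 1) := by
      rw [Real.rpow_sub_one hX.ne']
      field_simp
    have h2 : (T - t) ^ a * (T - t) ^ (-c) = (T - t) ^ (e - 1) := by
      rw [← Real.rpow_add hX]
      congr 1
      rw [he]; ring
    have h3 : β / e * ((-1) * e * (T - t) ^ (e - 1)) = -(β * (T - t) ^ (e - 1)) := by
      field_simp
    have hgt : (T - t) ^ a * g t = a * (T - t) ^ (a - 1) * Y t + β * (T - t) ^ (e - 1) := by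
      simp only [hg]
      rw [mul_add, ← mul_assoc, h1, mul_left_comm, h2]
    rw [h3, hgt]
    ring
  have hWc : ContinuousOn W (Icc 0 T'') := by
    have hp : ∀ r : ℝ, ContinuousOn (fun t : ℝ => (T - t) ^ r) (Icc 0 T'') := fun r =>
      (continuousOn_const.sub continuousOn_id).rpow_const fun t ht => Or.inl (hTt t ht).ne'
    exact ((hp a).mul hVc).add (continuousOn_const.mul (hp e))
  have hWanti : AntitoneOn W (Icc 0 T'') := by
    refine antitoneOn_of_deriv_nonpos (convex_Icc 0 T'') hWc ?_ ?_
    · rw [interior_Icc]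
      exact fun t ht => (hWd t ht).differentiableAt.differentiableWithinAt
    · rw [interior_Icc]
      intro t ht
      rw [(hWd t ht).deriv]
      have hX : 0 < T - t := hTt t ⟨ht.1.le, ht.2.le⟩
      have h1 : 0 ≤ a * (T - t) ^ (a - 1) := mul_nonneg ha (Real.rpow_nonneg hX.le _)
      have h2 : Y t - V t ≤ 0 := sub_nonpos.2 (hYV t ⟨ht.1.le, ht.2.le⟩)
      exact mul_nonpos_of_nonneg_of_nonpos h1 h2
  -- (iv) conclusion
  intro t ht
  have hX : 0 < T - t := hTt t ht
  have h0mem : (0 : ℝ) ∈ Icc 0 T'' := ⟨le_rfl, hT''.le⟩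
  have hWt : W t ≤ W 0 := hWanti h0mem ht ht.1
  have hW0 : W 0 = T ^ a * Y 0 + β / e * T ^ e := by
    simp only [hW, hV0, sub_zero]
  have hmain : (T - t) ^ a * V t ≤ T ^ a * Y 0 + β / e * T ^ e := by
    have hpos : 0 ≤ β / e * (T - t) ^ e := mul_nonneg (div_nonneg hβ he0.le) (Real.rpow_nonneg hX.le _)
    have : (T - t) ^ a * V t + β / e * (T - t) ^ e ≤ T ^ a * Y 0 + β / e * T ^ e := by
      rw [← hW0]; exact hWt
    linarith
  have hXa : 0 < (T - t) ^ a := Real.rpow_pos_of_pos hX a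
  have hVle : V t ≤ (T ^ a * Y 0 + β / e * T ^ e) * (T - t) ^ (-a) := by
    rw [Real.rpow_neg hX.le, ← div_eq_mul_inv, le_div_iff₀ hXa, mul_comm]
    exact hmain
  calc Y t ≤ V t := hYV t ht
    _ ≤ (T ^ a * Y 0 + β / e * T ^ e) * (T - t) ^ (-a) := hVle
    _ = (Y 0 * T ^ a + β * T ^ (a + 1 - c) / (a + 1 - c)) * (T - t) ^ (-a) := by
        rw [he]; ring

set_option maxHeartbeats 800000 in
/-- plate G34 «ForcedPowerGronwallSlab» PROVED.  On a closed slab `[0, T''] × ℝ³`, `0 < T'' < T`, for a classical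
unforced Navier–Stokes solution with bounded Sobolev seminorms: a stretching inequality
`2∫⟪ω,(∇u)ω⟫ ≤ ν∫|∇ω|²_F + (a/(T−t))∫|ω|² + β(T−t)^{−c}` (`a, β ≥ 0`, `c < a+1`) on `[0,T'']` yields
`∫|ω(t)|² ≤ (∫|ω(0)|²·T^a + βT^{a+1−c}/(a+1−c))(T−t)^{−a}` on `[0,T'']`.  Proof: the slab enstrophy balance
`Y(b) = Y(0) + ∫₀ᵇ 2∫⟪ω,∂ₜω⟫` (`IsSmoothSpaceTimeOn.l2_balance`), the energy identity
`∫⟪ω,∂ₜω⟫ = −ν∫|∇ω|²_F + ∫⟪ω,(∇u)ω⟫`, hence `Y' ≤ (a/(T−t))Y + β(T−t)^{−c}`, and `forced_power_gronwall_real`. -/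
theorem forcedPowerGronwallSlab_holds : ForcedPowerGronwallSlab := by
  intro ν T T'' a β c hν hT'' hT''T ha hβ hc u p hS hB hstr
  have hU : UniqueDiffOn ℝ (Icc 0 T'') := uniqueDiffOn_Icc hT''
  have h0S : (0 : ℝ) ∈ Icc 0 T'' := ⟨le_rfl, hT''.le⟩
  set κ : ℝ := ‖curlCLM‖ with hκ
  -- smoothness of the slices
  have hsm : ∀ t ∈ Icc 0 T'', ContDiff ℝ ∞ (u t) := fun t ht => hS.contDiff_velocity ht
  have hsm3 : ∀ t ∈ Icc 0 T'', ContDiff ℝ 3 (u t) := fun t ht => (hsm t ht).of_le (by norm_cast)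
  have hsm2 : ∀ t ∈ Icc 0 T'', ContDiff ℝ 2 (u t) := fun t ht => (hsm t ht).of_le (by norm_cast)
  -- sup bounds
  obtain ⟨B₀, hB₀⟩ := linfty_bound_of_hasBoundedSobolevNormsOn_holds hsm2 hB
  obtain ⟨B₁, hB₁0, hB₁⟩ := exists_forall_norm_fderiv_le_of_hasBoundedSobolevNormsOn hsm3 hB
  have hB₀0 : 0 ≤ B₀ := (norm_nonneg _).trans (hB₀ 0 h0S 0)
  -- the Sobolev bounds
  have hfin : ∀ n, ∀ t ∈ Icc 0 T'', ∫⁻ x, ‖iteratedFDeriv ℝ n (u t) x‖ₑ ^ 2 < ⊤ := fun n t ht => by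
    obtain ⟨C, hC⟩ := hB n
    exact (hC t ht).trans_lt ENNReal.coe_lt_top
  choose Cn hCn using hB
  -- the vorticity field and its time derivative
  set vort : ℝ → (EuclideanSpace ℝ (Fin 3)) → (EuclideanSpace ℝ (Fin 3)) := vorticity u with hωdef
  have hωt : ∀ t, vort t = curl (u t) := fun t => rfl
  have hωsm : IsSmoothSpaceTimeOn (Icc 0 T'') vort :=
    (hS.smooth_velocity.fderiv_slice hU).clm_comp curlCLM
  set W : ℝ → (EuclideanSpace ℝ (Fin 3)) → (EuclideanSpace ℝ (Fin 3)) :=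
    timeDerivWithin (Icc 0 T'') vort with hWdef
  have hvort : ∀ t ∈ Icc 0 T'', ∀ x,
      W t x + convect (u t) (vort t) x = convect (vort t) (u t) x + ν • (Δ (vort t)) x :=
    fun t ht x =>
    (hS.isVorticitySolutionOn_of_uniqueDiffOn hU (fun s _ y => curl_zero y)).vorticity_eq t ht x
  -- `L²` bound for the vorticity
  set V₀ : ℝ≥0∞ := ENNReal.ofReal (κ ^ 2) * (Cn 1 : ℝ≥0∞) with hV₀
  have hV₀top : V₀ < ⊤ := ENNReal.mul_lt_top ENNReal.ofReal_lt_top ENNReal.coe_lt_top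
  have hωL2 : ∀ t ∈ Icc 0 T'', ∫⁻ x, ‖vort t x‖ₑ ^ 2 ≤ V₀ := fun t ht =>
    (lintegral_curl_sq_le (u t)).trans (mul_le_mul' le_rfl (hCn 1 t ht))
  -- `L²` bound for the time derivative of the vorticity
  set V₁ : ℝ≥0∞ := 3 * (ENNReal.ofReal ((ν * (3 * κ)) ^ 2) * (Cn 3 : ℝ≥0∞) +
    ENNReal.ofReal ((B₀ * κ) ^ 2) * (Cn 2 : ℝ≥0∞) + ENNReal.ofReal ((B₁ * κ) ^ 2) * (Cn 1 : ℝ≥0∞))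
    with hV₁
  have hV₁top : V₁ < ⊤ := by
    refine ENNReal.mul_lt_top (by norm_num) ?_
    refine ENNReal.add_lt_top.2 ⟨ENNReal.add_lt_top.2 ⟨?_, ?_⟩, ?_⟩ <;>
      exact ENNReal.mul_lt_top ENNReal.ofReal_lt_top ENNReal.coe_lt_top
  have hWL2 : ∀ t ∈ Icc 0 T'', ∫⁻ x, ‖W t x‖ₑ ^ 2 ≤ V₁ := by
    intro t ht
    refine (lintegral_enorm_sq_le_of_vorticity_eq hν hB₀0 hB₁0 (hsm3 t ht) (hB₀ t ht) (hB₁ t ht)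
      (fun x => by rw [← hωt t]; exact hvort t ht x)).trans ?_
    rw [hV₁]
    exact mul_le_mul' le_rfl (add_le_add (add_le_add (mul_le_mul' le_rfl (hCn 3 t ht))
      (mul_le_mul' le_rfl (hCn 2 t ht))) (mul_le_mul' le_rfl (hCn 1 t ht)))
  -- the balance of the enstrophy (WITH its integrability clause)
  obtain ⟨hΦi, hYcont, hbal⟩ := hωsm.l2_balance hT'' (C₀ := V₀.toNNReal) (C₁ := V₁.toNNReal)
    (fun t ht => by rw [ENNReal.coe_toNNReal hV₀top.ne]; exact hωL2 t ht)
    (fun t ht => by rw [ENNReal.coe_toNNReal hV₁top.ne]; exact hWL2 t ht)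
  -- the quantities
  set Y : ℝ → ℝ := fun t => ∫ x, ‖vort t x‖ ^ 2 with hYdef
  set Φ : ℝ → ℝ := fun t => ∫ x, 2 * ⟪vort t x, W t x⟫ with hΦdef
  -- the slice inequality `Φ t ≤ (a/(T−t)) Y t + β (T−t)^{−c}`
  have hslice : ∀ t ∈ Icc 0 T'', Φ t ≤ a / (T - t) * Y t + β * (T - t) ^ (-c) := by
    intro t ht
    have hv := hsm3 t ht
    have hid := integral_inner_curl_eq_of_vorticity_eq hv (hS.divFree t ht) (hvort t ht)
      (hB₀ t ht) (hB₁ t ht) (hfin 1 t ht) (hfin 2 t ht) (hfin 3 t ht)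
    have hst := hstr t ht
    have hDnn : 0 ≤ ∫ x, frobeniusNormSq (fderiv ℝ (curl (u t)) x) :=
      integral_nonneg fun x => frobeniusNormSq_nonneg _
    have hΦt : Φ t = 2 * ∫ x, ⟪vort t x, W t x⟫ := by
      rw [hΦdef]
      exact integral_const_mul _ _
    rw [hΦt, hωt, hid]
    have hYt : Y t = ∫ x, ‖curl (u t) x‖ ^ 2 := rfl
    rw [hYt]
    nlinarith [hst, hν, hDnn, mul_nonneg hν.le hDnn]
  -- the real-variable lemma
  intro t ht
  have h := forced_power_gronwall_real hT'' hT''T ha hβ hc hYcont hΦi hbal hslice t ht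
  exact h

end Summit.NavierStokesRegularity.NavierStokesRegularity.Theorems.IntenseSetDoors

end
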